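import Literature.NumberTheory.NumberFields.IntegralBasisCriterion
import Mathlib.NumberTheory.NumberField.Basic
import Mathlib.FieldTheory.PrimitiveElement
import Mathlib.RingTheory.Polynomial.GaussLemma
import Mathlib.Algebra.Polynomial.SpecificDegree
import Mathlib.Tactic.ComputeDegree
import HarnessLib

/-!
# BirchSwinnertonDyer — rank ≥ 2 observatory: explicit quadratic fields `K = ℚ(θ)`, `θ² + aθ + b = 0`

HONEST FRAMING: per-curve certified theorems and census instruments; no claim on BSD in rank ≥ 2.

Generic piece of the successor instrument KERNEL-2DESC-Z2 (design
`b2b-bsdr2-cert-3/KERNEL-TRANSPORT.md` § "Successor design … KERNEL-2DESC-Z2", spec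
`code/b2b-bsdr2-cert-3/kernel-2desc-z2/README-Z2.md`): the QUADRATIC twin of the cubic instrument's
`Literature.NumberTheory.NumberFields.MonicCubic` (`CubicFieldExplicit.lean`) and of the model
`CubicField` (`…2DescSignature.lean`). For `K = ℚ(θ)` a number field of degree `2` generated by a
root `θ` of the irreducible monic integer quadratic `f = X² + aX + b`:

* irreducibility of `f` from `a² − 4b` not a square (`irreducible_polyQ`);
* the power basis `1, θ` (`MonicQuad.pb`), the companion matrix, `Tr(x + yθ) = 2x − ay`,
  `N(x + yθ) = x² − axy + by²` (`trace_lin`, `norm_lin`), `disc(1, θ) = a² − 4b` (`discr_pb`);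
* `θ` as an algebraic integer (`thetaInt`); `𝓞 K = ℤ[θ]` and `d_K = a² − 4b` from the square-factor
  condition of Marcus Ex. 2.27 via the tree's `IntegralBasisCriterion` (`mem_adjoin_theta`,
  `discr_eq_disc`) — e.g. `a² − 4b` squarefree;
* `|d_K| ≤ |a² − 4b|` unconditionally (`abs_discr_le_abs_disc`);
* the concrete model `QuadField a b = ℚ[X]/(f)` with its root and `finrank = 2`.

Sorry-free; axioms `propext`, `Classical.choice`, `Quot.sound`.
[cite: Marcus2018, Ch. 2, Thm. 4, Thm. 8, Exercises 17 and 27]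
-/

-- single-conjunct summit: `Summit.BirchSwinnertonDyer.BirchSwinnertonDyer.…` repeats the name by design
set_option linter.dupNamespace false

noncomputable section

open Polynomial Module NumberField IntermediateField
open scoped NumberField
open Literature.NumberTheory.NumberFields

namespace Summit.BirchSwinnertonDyer.BirchSwinnertonDyer.Rank2Observatory.TwoDescZ2

namespace MonicQuad

/-! ### The polynomial and its invariants -/

/-- The monic integer quadratic `f = X² + aX + b`. [folklore] -/
def poly (a b : ℤ) : ℤ[X] := X ^ 2 + C a * X + C b

/-- `f` is monic. [folklore] -/
theorem monic_poly (a b : ℤ) : (poly a b).Monic := by unfold poly; monicity!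

/-- `f` has degree `2`. [folklore] -/
theorem natDegree_poly (a b : ℤ) : (poly a b).natDegree = 2 := by
  unfold poly; compute_degree!

/-- `f` over `ℚ`. [folklore] -/
def polyQ (a b : ℤ) : ℚ[X] := (poly a b).map (algebraMap ℤ ℚ)

/-- `f` over `ℚ`, written out. [folklore] -/
theorem polyQ_eq (a b : ℤ) : polyQ a b = X ^ 2 + C (a : ℚ) * X + C (b : ℚ) := by
  simp [polyQ, poly, Polynomial.map_add, Polynomial.map_mul, Polynomial.map_pow]

/-- `f` over `ℚ` is monic. [folklore] -/
theorem monic_polyQ (a b : ℤ) : (polyQ a b).Monic := (monic_poly a b).map _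

/-- `f` over `ℚ` has degree `2`. [folklore] -/
theorem natDegree_polyQ (a b : ℤ) : (polyQ a b).natDegree = 2 := by
  rw [polyQ, (monic_poly a b).natDegree_map, natDegree_poly]

/-- The discriminant `Δ(f) = a² − 4b`. [folklore] -/
def disc (a b : ℤ) : ℤ := a ^ 2 - 4 * b

/-- The companion matrix of `f`: multiplication by `θ` on the basis `1, θ` (columns = the
coordinates of `θ, θ² = −b − aθ`). [folklore] -/
def companion (a b : ℤ) : Matrix (Fin 2) (Fin 2) ℚ := !![0, -(b : ℚ); 1, -(a : ℚ)]

/-- The norm form `N(x + yθ) = (x + yθ)(x + yθ̄) = x² − axy + by²`. [cite: Marcus2018, Ch. 2, Thm. 4] -/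
def normForm (a b : ℤ) (x y : ℚ) : ℚ := x ^ 2 - a * x * y + b * y ^ 2

/-- **Non-squares by reduction**: if `d` is not a square modulo `p`, it is not a square in `ℤ`
(kernel-decidable test for `irreducible_polyQ`). [folklore] -/
theorem not_isSquare_of_zmod {d : ℤ} (p : ℕ) (h : ∀ t : ZMod p, t * t ≠ (d : ZMod p)) :
    ¬ IsSquare d := by
  rintro ⟨r, hr⟩
  exact h (r : ZMod p) (by rw [hr]; push_cast; ring)

/-- **Irreducibility**: if `a² − 4b` is not a square then `f` is irreducible over `ℚ` (a rational
root `q` would give `(2q + a)² = a² − 4b`). [folklore] -/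
theorem irreducible_polyQ {a b : ℤ} (h : ¬ IsSquare (disc a b)) : Irreducible (polyQ a b) := by
  apply Polynomial.irreducible_of_degree_le_three_of_not_isRoot
  · rw [natDegree_polyQ]; decide
  · intro q hq
    apply h
    rw [← Rat.isSquare_intCast_iff]
    refine ⟨2 * q + a, ?_⟩
    rw [IsRoot, polyQ_eq] at hq
    simp only [eval_add, eval_mul, eval_pow, eval_X, eval_C] at hq
    simp only [disc, Int.cast_sub, Int.cast_mul, Int.cast_pow, Int.cast_ofNat]
    linear_combination (-4 : ℚ) * hq

/-! ### A quadratic field generated by a root -/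

section Root

variable {K : Type*} [Field K] [NumberField K] {a b : ℤ} {θ : K}

/-- A root of `f` is a root of `f` over `ℚ`. [folklore] -/
theorem aeval_polyQ (hθ : aeval θ (poly a b) = 0) : aeval θ (polyQ a b) = 0 := by
  rw [polyQ, aeval_map_algebraMap]; exact hθ

omit [NumberField K] in
/-- The quadratic relation `θ² + aθ + b = 0` in `K`. [folklore] -/
theorem theta_rel (hθ : aeval θ (poly a b) = 0) : θ ^ 2 + (a : K) * θ + (b : K) = 0 := by
  have := hθ
  simp only [poly, map_add, map_mul, map_pow, aeval_X, eq_intCast, map_intCast] at this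
  linear_combination this

omit [NumberField K] in
/-- A root of the monic integer quadratic `f` is an algebraic integer. [folklore] -/
theorem isIntegral_of_aeval (hθ : aeval θ (poly a b) = 0) : IsIntegral ℤ θ :=
  ⟨poly a b, monic_poly a b, hθ⟩

/-- The minimal polynomial over `ℚ` of a root of an irreducible `f` is `f`. [folklore] -/
theorem minpoly_rat_eq (hirr : Irreducible (polyQ a b)) (hθ : aeval θ (poly a b) = 0) :
    minpoly ℚ θ = polyQ a b :=
  (minpoly.eq_of_irreducible_of_monic hirr (aeval_polyQ hθ) (monic_polyQ a b)).symm

/-- The minimal polynomial over `ℤ` of a root of an irreducible `f` is `f`. [folklore] -/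
theorem minpoly_int_eq (hirr : Irreducible (polyQ a b)) (hθ : aeval θ (poly a b) = 0) :
    minpoly ℤ θ = poly a b := by
  apply Polynomial.map_injective (algebraMap ℤ ℚ) (algebraMap ℤ ℚ).injective_int
  rw [← minpoly.isIntegrallyClosed_eq_field_fractions' ℚ (isIntegral_of_aeval hθ),
    minpoly_rat_eq hirr hθ]
  rfl

/-- `ℚ(θ) = K` when `[K : ℚ] = 2` and `f` is irreducible. [folklore] -/
theorem adjoin_root_eq_top (hirr : Irreducible (polyQ a b)) (hθ : aeval θ (poly a b) = 0)
    (h2 : finrank ℚ K = 2) : ℚ⟮θ⟯ = ⊤ :=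
  (Field.primitive_element_iff_minpoly_natDegree_eq ℚ θ).mpr
    (by rw [minpoly_rat_eq hirr hθ, natDegree_polyQ, h2])

/-- The power basis `1, θ` of `K = ℚ(θ)`. [folklore] -/
def pb (hirr : Irreducible (polyQ a b)) (hθ : aeval θ (poly a b) = 0) (h2 : finrank ℚ K = 2) :
    PowerBasis ℚ K :=
  (adjoin.powerBasis (isIntegral_of_aeval hθ).tower_top).map
    ((equivOfEq (adjoin_root_eq_top hirr hθ h2)).trans topEquiv)

/-- The generator of `pb` is `θ`. [folklore] -/
theorem pb_gen (hirr : Irreducible (polyQ a b)) (hθ : aeval θ (poly a b) = 0)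
    (h2 : finrank ℚ K = 2) : (pb hirr hθ h2).gen = θ := rfl

/-- `pb` has dimension `2`. [folklore] -/
theorem pb_dim (hirr : Irreducible (polyQ a b)) (hθ : aeval θ (poly a b) = 0)
    (h2 : finrank ℚ K = 2) : (pb hirr hθ h2).dim = 2 := by
  rw [pb, PowerBasis.map_dim, adjoin.powerBasis_dim, minpoly_rat_eq hirr hθ, natDegree_polyQ]

/-- The basis `1, θ` indexed by `Fin 2`. [folklore] -/
def basis (hirr : Irreducible (polyQ a b)) (hθ : aeval θ (poly a b) = 0)
    (h2 : finrank ℚ K = 2) : Basis (Fin 2) ℚ K :=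
  (pb hirr hθ h2).basis.reindex (finCongr (pb_dim hirr hθ h2))

/-- `basis i = θ ^ i`. [folklore] -/
theorem basis_apply (hirr : Irreducible (polyQ a b)) (hθ : aeval θ (poly a b) = 0)
    (h2 : finrank ℚ K = 2) (i : Fin 2) : basis hirr hθ h2 i = θ ^ (i : ℕ) := by
  rw [basis, Basis.reindex_apply, (pb hirr hθ h2).coe_basis, pb_gen]
  rfl

/-- `θ² = −b − aθ` in the basis `1, θ`. [folklore] -/
theorem pow_two_eq (hirr : Irreducible (polyQ a b)) (hθ : aeval θ (poly a b) = 0)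
    (h2 : finrank ℚ K = 2) :
    θ ^ 2 = (-(b : ℚ)) • basis hirr hθ h2 0 + (-(a : ℚ)) • basis hirr hθ h2 1 := by
  have h := theta_rel hθ
  simp only [basis_apply, Fin.val_zero, Fin.val_one, pow_zero, pow_one, Algebra.smul_def, map_neg,
    map_intCast]
  linear_combination h

/-- Coordinates of `θ` in `1, θ`. [folklore] -/
theorem repr_pow_one (hirr : Irreducible (polyQ a b)) (hθ : aeval θ (poly a b) = 0)
    (h2 : finrank ℚ K = 2) : (basis hirr hθ h2).repr (θ ^ 1) = Finsupp.single 1 1 := by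
  rw [show θ ^ 1 = basis hirr hθ h2 1 by rw [basis_apply]; rfl, Basis.repr_self]

/-- Coordinates of `θ²` in `1, θ`. [folklore] -/
theorem repr_pow_two (hirr : Irreducible (polyQ a b)) (hθ : aeval θ (poly a b) = 0)
    (h2 : finrank ℚ K = 2) :
    (basis hirr hθ h2).repr (θ ^ 2) = Finsupp.single 0 (-(b : ℚ)) + Finsupp.single 1 (-(a : ℚ)) := by
  rw [pow_two_eq hirr hθ h2]
  simp only [map_add, map_smul, Basis.repr_self, Finsupp.smul_single_one]

/-- Multiplication by `θ` has matrix `companion a b` in the basis `1, θ`. [folklore] -/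
theorem leftMulMatrix_theta (hirr : Irreducible (polyQ a b)) (hθ : aeval θ (poly a b) = 0)
    (h2 : finrank ℚ K = 2) : Algebra.leftMulMatrix (basis hirr hθ h2) θ = companion a b := by
  ext i j
  rw [Algebra.leftMulMatrix_eq_repr_mul, basis_apply, ← pow_succ']
  fin_cases j
  · change ((basis hirr hθ h2).repr (θ ^ 1)) i = companion a b i 0
    rw [repr_pow_one]
    fin_cases i <;> simp [companion]
  · change ((basis hirr hθ h2).repr (θ ^ 2)) i = companion a b i 1
    rw [repr_pow_two]
    fin_cases i <;> simp [companion]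

/-- `Tr(θᵏ) = tr(Cᵏ)`. [cite: Marcus2018, Ch. 2, Thm. 4] -/
theorem trace_theta_pow (hirr : Irreducible (polyQ a b)) (hθ : aeval θ (poly a b) = 0)
    (h2 : finrank ℚ K = 2) (k : ℕ) :
    Algebra.trace ℚ K (θ ^ k) = Matrix.trace (companion a b ^ k) := by
  rw [Algebra.trace_eq_matrix_trace (basis hirr hθ h2), map_pow, leftMulMatrix_theta]

/-- **`disc(1, θ) = a² − 4b`**, the determinant of the trace form `[[2, −a], [−a, a² − 2b]]`.
[cite: Marcus2018, Ch. 2, Thm. 8 and Exercise 17] -/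
theorem discr_basis (hirr : Irreducible (polyQ a b)) (hθ : aeval θ (poly a b) = 0)
    (h2 : finrank ℚ K = 2) : Algebra.discr ℚ ⇑(basis hirr hθ h2) = (disc a b : ℚ) := by
  rw [Algebra.discr_def, Matrix.det_fin_two]
  simp only [Algebra.traceMatrix_apply, Algebra.traceForm_apply, basis_apply, ← pow_add,
    trace_theta_pow hirr hθ h2]
  simp [companion, pow_succ, Matrix.trace_fin_two, disc]
  ring

/-- **`disc(1, θ) = a² − 4b`** for the power basis `pb`. [cite: Marcus2018, Ch. 2, Thm. 8] -/
theorem discr_pb (hirr : Irreducible (polyQ a b)) (hθ : aeval θ (poly a b) = 0)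
    (h2 : finrank ℚ K = 2) : Algebra.discr ℚ ⇑(pb hirr hθ h2).basis = (disc a b : ℚ) := by
  rw [← discr_basis hirr hθ h2, basis, Basis.coe_reindex, Algebra.discr_reindex]

/-- Multiplication by `x + yθ` has matrix `x·1 + y·C`. [cite: Marcus2018, Ch. 2, Thm. 4] -/
theorem leftMulMatrix_lin (hirr : Irreducible (polyQ a b)) (hθ : aeval θ (poly a b) = 0)
    (h2 : finrank ℚ K = 2) (x y : ℚ) :
    Algebra.leftMulMatrix (basis hirr hθ h2) ((x : K) + (y : K) * θ) =
      x • (1 : Matrix (Fin 2) (Fin 2) ℚ) + y • companion a b := by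
  have hx : (x : K) = algebraMap ℚ K x := rfl
  have hy : (y : K) * θ = y • θ := (Algebra.smul_def y θ).symm
  rw [hx, hy, map_add, AlgHom.commutes, map_smul, leftMulMatrix_theta,
    Algebra.algebraMap_eq_smul_one]

/-- **Trace of a general element**: `Tr(x + yθ) = 2x − ay`. [cite: Marcus2018, Ch. 2, Thm. 4] -/
theorem trace_lin (hirr : Irreducible (polyQ a b)) (hθ : aeval θ (poly a b) = 0)
    (h2 : finrank ℚ K = 2) (x y : ℚ) :
    Algebra.trace ℚ K ((x : K) + (y : K) * θ) = 2 * x - a * y := by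
  rw [Algebra.trace_eq_matrix_trace (basis hirr hθ h2), leftMulMatrix_lin hirr hθ h2]
  simp [companion, Matrix.trace_fin_two]
  ring

/-- **Norm of a general element**: `N(x + yθ) = x² − axy + by²`. [cite: Marcus2018, Ch. 2, Thm. 4] -/
theorem norm_lin (hirr : Irreducible (polyQ a b)) (hθ : aeval θ (poly a b) = 0)
    (h2 : finrank ℚ K = 2) (x y : ℚ) :
    Algebra.norm ℚ ((x : K) + (y : K) * θ) = normForm a b x y := by
  rw [Algebra.norm_eq_matrix_det (basis hirr hθ h2), leftMulMatrix_lin hirr hθ h2,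
    Matrix.det_fin_two]
  simp [companion, Matrix.add_apply, Matrix.smul_apply, normForm]
  ring

/-! ### `θ` as an algebraic integer; `𝓞 K = ℤ[θ]` and `d_K` -/

/-- A root of `f`, as an element of `𝓞 K`. [folklore] -/
def thetaInt (hθ : aeval θ (poly a b) = 0) : 𝓞 K := ⟨θ, isIntegral_of_aeval hθ⟩

omit [NumberField K] in
/-- The coercion of `thetaInt hθ : 𝓞 K` back to `K` is `θ` (definitional). [folklore] -/
@[simp] theorem coe_thetaInt (hθ : aeval θ (poly a b) = 0) : ((thetaInt hθ : 𝓞 K) : K) = θ := rfl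

/-- `thetaInt hθ` is a root of `f` in `𝓞 K`. [folklore] -/
theorem aeval_thetaInt (hθ : aeval θ (poly a b) = 0) : aeval (thetaInt hθ) (poly a b) = 0 := by
  apply IsFractionRing.injective (𝓞 K) K
  rw [map_zero, ← aeval_algebraMap_apply]
  exact hθ

/-- The quadratic relation in `𝓞 K`. [folklore] -/
theorem thetaInt_rel (hθ : aeval θ (poly a b) = 0) :
    (thetaInt hθ) ^ 2 + (a : 𝓞 K) * thetaInt hθ + (b : 𝓞 K) = 0 := by
  have := aeval_thetaInt hθ
  simp only [poly, map_add, map_mul, map_pow, aeval_X, eq_intCast, map_intCast] at this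
  linear_combination this

/-- The generator of `pb` is integral. [folklore] -/
theorem isIntegral_pb_gen (hirr : Irreducible (polyQ a b)) (hθ : aeval θ (poly a b) = 0)
    (h2 : finrank ℚ K = 2) : IsIntegral ℤ (pb hirr hθ h2).gen :=
  isIntegral_of_aeval hθ

/-- **`Δ(f) = (index)²·d_K`**. [cite: Marcus2018, Ch. 2, Ex. 27] -/
theorem disc_eq_indexDet_sq_mul_discr (hirr : Irreducible (polyQ a b))
    (hθ : aeval θ (poly a b) = 0) (h2 : finrank ℚ K = 2) :
    disc a b = indexDet (pb hirr hθ h2) (isIntegral_pb_gen hirr hθ h2) ^ 2 * NumberField.discr K := by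
  have h := discr_powerBasis_eq_indexDet_sq_mul_discr (pb hirr hθ h2) (isIntegral_pb_gen hirr hθ h2)
  rw [discr_pb hirr hθ h2] at h
  exact_mod_cast h

/-- **`|d_K| ≤ |Δ(f)|`**. [cite: Marcus2018, Ch. 2, Ex. 27] -/
theorem abs_discr_le_abs_disc (hirr : Irreducible (polyQ a b)) (hθ : aeval θ (poly a b) = 0)
    (h2 : finrank ℚ K = 2) : |NumberField.discr K| ≤ |disc a b| := by
  have hne := indexDet_ne_zero (pb hirr hθ h2) (isIntegral_pb_gen hirr hθ h2)
  rw [disc_eq_indexDet_sq_mul_discr hirr hθ h2, abs_mul, abs_pow]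
  have h1 : 1 ≤ |indexDet (pb hirr hθ h2) (isIntegral_pb_gen hirr hθ h2)| ^ 2 :=
    one_le_pow₀ (Int.one_le_abs hne)
  calc |NumberField.discr K| = 1 * |NumberField.discr K| := (one_mul _).symm
    _ ≤ _ := mul_le_mul_of_nonneg_right h1 (abs_nonneg _)

/-- `0 < d_K ↔ 0 < Δ(f)`. [cite: Marcus2018, Ch. 2, Ex. 27] -/
theorem discr_pos_iff_disc_pos (hirr : Irreducible (polyQ a b)) (hθ : aeval θ (poly a b) = 0)
    (h2 : finrank ℚ K = 2) : 0 < NumberField.discr K ↔ 0 < disc a b := by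
  have hne := indexDet_ne_zero (pb hirr hθ h2) (isIntegral_pb_gen hirr hθ h2)
  have hpos : 0 < indexDet (pb hirr hθ h2) (isIntegral_pb_gen hirr hθ h2) ^ 2 := by positivity
  rw [disc_eq_indexDet_sq_mul_discr hirr hθ h2]
  constructor
  · intro h; exact mul_pos hpos h
  · intro h; exact pos_of_mul_pos_right h hpos.le

/-- **`𝓞 K = ℤ[θ]`** when every factorisation `Δ(f) = r²e`, `|e| > 2`, has `r = ±1` (e.g. `Δ(f)`
squarefree). [cite: Marcus2018, Ch. 2, Exercise 27] -/
theorem mem_adjoin_theta (hirr : Irreducible (polyQ a b)) (hθ : aeval θ (poly a b) = 0)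
    (h2 : finrank ℚ K = 2) (hsq : ∀ r e : ℤ, disc a b = r ^ 2 * e → 2 < |e| → IsUnit r)
    (x : 𝓞 K) : (x : K) ∈ Algebra.adjoin ℤ ({θ} : Set K) :=
  mem_adjoin_of_isUnit_indexDet (pb hirr hθ h2) (isIntegral_pb_gen hirr hθ h2)
    (isUnit_indexDet_of_discr_eq (pb hirr hθ h2) (isIntegral_pb_gen hirr hθ h2)
      (by rw [h2]; norm_num) (disc a b) (discr_pb hirr hθ h2) hsq) x

/-- Under the same condition every algebraic integer is `p + qθ` with `p, q ∈ ℤ`. [cite: Marcus2018, Ch. 2, Exercise 27] -/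
theorem exists_int_coords (hirr : Irreducible (polyQ a b)) (hθ : aeval θ (poly a b) = 0)
    (h2 : finrank ℚ K = 2) (hsq : ∀ r e : ℤ, disc a b = r ^ 2 * e → 2 < |e| → IsUnit r)
    (x : 𝓞 K) : ∃ p q : ℤ, (x : K) = (p : K) + (q : K) * θ := by
  have hx := mem_adjoin_theta hirr hθ h2 hsq x
  rw [Algebra.adjoin_singleton_eq_range_aeval] at hx
  obtain ⟨g, hg⟩ := hx
  -- reduce `g` modulo the monic `f`: `g = r + f * q`, `deg r < 2`
  refine ⟨(g %ₘ poly a b).coeff 0, (g %ₘ poly a b).coeff 1, ?_⟩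
  have hne1 : poly a b ≠ 1 := by
    intro h
    have := natDegree_poly a b
    rw [h, natDegree_one] at this
    exact absurd this (by decide)
  have hdeg : (g %ₘ poly a b).natDegree < 2 := by
    have := natDegree_modByMonic_lt g (monic_poly a b) hne1
    rwa [natDegree_poly] at this
  have hev : aeval θ g = aeval θ (g %ₘ poly a b) := by
    conv_lhs => rw [← modByMonic_add_div g (poly a b)]
    rw [map_add, map_mul, hθ, zero_mul, add_zero]
  rw [← hg]
  change (aeval θ g : K) = _
  rw [hev, aeval_eq_sum_range' hdeg]
  simp [Finset.sum_range_succ, mul_comm]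

/-- **`d_K = Δ(f)`** under the same condition. [cite: Marcus2018, Ch. 2, Exercise 27] -/
theorem discr_eq_disc (hirr : Irreducible (polyQ a b)) (hθ : aeval θ (poly a b) = 0)
    (h2 : finrank ℚ K = 2) (hsq : ∀ r e : ℤ, disc a b = r ^ 2 * e → 2 < |e| → IsUnit r) :
    NumberField.discr K = disc a b :=
  discr_eq_of_isUnit_indexDet (pb hirr hθ h2) (isIntegral_pb_gen hirr hθ h2)
    (isUnit_indexDet_of_discr_eq (pb hirr hθ h2) (isIntegral_pb_gen hirr hθ h2)
      (by rw [h2]; norm_num) (disc a b) (discr_pb hirr hθ h2) hsq) (disc a b) (discr_pb hirr hθ h2)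

/-- The square-factor condition holds when `Δ(f)` is squarefree. [folklore] -/
theorem sqCond_of_squarefree (h : Squarefree (disc a b)) :
    ∀ r e : ℤ, disc a b = r ^ 2 * e → 2 < |e| → IsUnit r := by
  intro r e hre _
  exact h r ⟨e, by rw [hre]; ring⟩

end Root

end MonicQuad

/-! ## The concrete model `ℚ[X]/(f)` -/

section Model

variable (a b : ℤ) [Fact (Irreducible (MonicQuad.polyQ a b))]

/-- **The quadratic field `ℚ(θ) = ℚ[X]/(f)`**, `f = X² + aX + b` irreducible. [folklore] -/
abbrev QuadField : Type := AdjoinRoot (MonicQuad.polyQ a b)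

namespace QuadField

/-- The root `θ = X mod f`. [folklore] -/
def root : QuadField a b := AdjoinRoot.root (MonicQuad.polyQ a b)

/-- `f(θ) = 0` (integer-coefficient form). [folklore] -/
theorem aeval_root : aeval (root a b) (MonicQuad.poly a b) = 0 := by
  have hφ : (algebraMap ℤ (QuadField a b)) =
      (AdjoinRoot.of (MonicQuad.polyQ a b)).comp (algebraMap ℤ ℚ) := RingHom.ext_int _ _
  rw [aeval_def, hφ, ← eval₂_map]
  exact AdjoinRoot.eval₂_root (MonicQuad.polyQ a b)

/-- `[ℚ(θ) : ℚ] = 2`. [folklore] -/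
theorem finrank_eq : finrank ℚ (QuadField a b) = 2 := by
  rw [PowerBasis.finrank (AdjoinRoot.powerBasis (MonicQuad.monic_polyQ a b).ne_zero),
    AdjoinRoot.powerBasis_dim, MonicQuad.natDegree_polyQ]

end QuadField

end Model

end Summit.BirchSwinnertonDyer.BirchSwinnertonDyer.Rank2Observatory.TwoDescZ2

end
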